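import Literature.NumberTheory.Automorphic.ShimuraCurveCovolume
import Literature.NumberTheory.Automorphic.ShimuraCurveDivisionLattice
import Literature.NumberTheory.Automorphic.ShimuraCurveOrbitIdealCount
import Literature.NumberTheory.Automorphic.QuaternionLocalEichlerPair
import Literature.NumberTheory.Automorphic.EichlerOrderLocallyMaximal
import Literature.NumberTheory.Automorphic.QuaternionLocalRamified
import Literature.NumberTheory.Automorphic.QuaternionLocalSplit
import HarnessLib

/-!
# The Eichler order of `X₀^D(M)`: negative norms, the standard local models at `p ∤ D`, and
# elements of `O₍ₚ₎` with reduced norm `p`-adically close to a prescribed unit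

Topic `NumberTheory/Automorphic`; theorems only (no definition, no named fact, no instance).
Three local–global utilities for a Shimura curve datum `X : ShimuraCurveData D M` with `D > 1`
(`B = X.B` the division quaternion algebra of discriminant `D`, `O = X.O` an Eichler order of
level `M`, `ι : B → M₂(ℝ)` the real splitting):

* `ShimuraCurveData.exists_reducedNorm_neg` — **`B` is indefinite**: some `x ∈ B` has
  `nrd(x) < 0` (`nrd = det ∘ ι`, `ι(B)` contains an `ℝ`-basis of `M₂(ℝ)`
  (`exists_basis_real`), `det` is continuous and negative at `diag(1, -1)`, and `ℚ⁴` is dense in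
  `ℝ⁴`);
* `ShimuraCurveData.exists_eichler_model_localAt` — **at a prime `p ∤ D` the localisation
  `O₍ₚ₎` is a standard local Eichler order**: there are a matrix model `Ψ : B → M₂(ℚ_p)` and
  `e ≥ 0` with `O₍ₚ₎ = {x | Ψ(x) ∈ M₂(ℤ_p), Ψ(x)₂₁ ∈ p^e ℤ_p}` (Vignéras II §2 Thm. 2.3 (2),
  Lemme 2.4; `e = 0` when `p ∤ M`, from `exists_conjUnit_localAt_iff`, and the Eichler model
  `exists_eichler_model` when `p ∣ M`);
* `ShimuraCurveData.exists_mem_localAt_reducedNorm_eq_mul_of_not_dvd` — **local units are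
  norms of `O₍ₚ₎` up to `p`-adically small factors**: for `p ∤ D`, a rational `p`-adic unit `u`
  and `m ≥ 0` there is `g ∈ O₍ₚ₎` with `nrd(g) = u (1 + p^m r)`, `r ∈ ℤ₍ₚ₎` (approximate
  `diag(u, 1)` by `Ψ(g)`, density of `Ψ(B)` in `M₂(ℚ_p)`, `AlgHom.exists_norm_sub_le`).

These are the local inputs (surjectivity of `nrd : O_pˣ → ℤ_pˣ` in approximate form, and the
sign freedom of global norms) of Eichler's theorem that the locally principal ideals of `O` are
principal with generators of positive norm, via Kneser's strong approximation theorem (Vignéras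
III §4 Thm. 4.3, §5 Cor. 5.7), on the way to
`Literature.NumberTheory.Automorphic.ShimuraCurveData.volume_fd_eq`.

## References

* M.-F. Vignéras, *Arithmétique des algèbres de quaternions*, LNM 800 (1980), Ch. II §2
  Thm. 2.3, Lemme 2.4; Ch. III §4 Thm. 4.1, 4.3, §5 [VignerasLNM800].
* J. Voight, *Quaternion Algebras*, GTM 288 (2021), 23.4.19, §28.2 [Voight2021].
-/

open Filter Finset
open scoped Pointwise Topology

namespace Literature.NumberTheory.Automorphic

namespace ShimuraCurveData

variable {D M : ℕ} (X : ShimuraCurveData D M)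

/-! ### `B` is indefinite: negative reduced norms -/

/-- **`nrd` takes a negative value on `B`**: the real splitting `ι : B → M₂(ℝ)` has `det ∘ ι = nrd`
and `ι(B)` is dense in `M₂(ℝ)` (it contains an `ℝ`-basis, and `ℚ` is dense in `ℝ`), where `det`
is negative at `diag(1, -1)`. [folklore] -/
theorem exists_reducedNorm_neg (hD : 1 < D) : ∃ x : X.B, reducedNorm ℚ X.B x < 0 := by
  classical
  have hdiv : ∀ x : X.B, x ≠ 0 → IsUnit x := fun x hx => X.isUnit_of_ne_zero hD x hx
  obtain ⟨n, b, b', hb'⟩ := X.exists_basis_real hdiv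
  -- the target matrix and its coordinates
  set T : Matrix (Fin 2) (Fin 2) ℝ := !![1, 0; 0, -1] with hT
  have hTdet : T.det < 0 := by rw [hT, Matrix.det_fin_two_of]; norm_num
  set c : Fin n → ℝ := fun i => b'.repr T i with hc
  -- `det (∑ q_i b'_i)` is continuous in `q` and negative at `c`
  set f : (Fin n → ℝ) → ℝ := fun q => (∑ i, q i • b' i).det with hf
  have hfc : f c = T.det := by
    simp only [hf, hc]
    rw [b'.sum_repr T]
  have hfcont : Continuous f :=
    (continuous_finsetSum _ fun i _ => (continuous_apply i).smul continuous_const).matrix_det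
  have hopen : IsOpen (f ⁻¹' Set.Iio 0) := hfcont.isOpen_preimage _ isOpen_Iio
  have hcmem : c ∈ f ⁻¹' Set.Iio 0 := by rw [Set.mem_preimage, hfc]; exact hTdet
  -- a rational point nearby
  have hdense : Dense (Set.range fun q : Fin n → ℚ => fun i => (q i : ℝ)) := by
    have h : (Set.range fun q : Fin n → ℚ => fun i => (q i : ℝ)) =
        Set.pi Set.univ fun _ => Set.range (Rat.cast : ℚ → ℝ) := by
      ext r
      simp only [Set.mem_range, Set.mem_pi, Set.mem_univ, true_implies]
      constructor
      · rintro ⟨q, rfl⟩ i; exact ⟨q i, rfl⟩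
      · intro h
        choose q hq using h
        exact ⟨q, funext hq⟩
    rw [h]
    exact dense_pi Set.univ fun i _ => Rat.denseRange_cast
  obtain ⟨_, ⟨q, rfl⟩, hr⟩ := hdense.exists_mem_open hopen ⟨c, hcmem⟩
  refine ⟨∑ i, q i • (b i : X.B), ?_⟩
  have hι : X.ι (∑ i, q i • (b i : X.B)) = ∑ i, (q i : ℝ) • b' i := by
    rw [map_sum]
    refine Finset.sum_congr rfl fun i _ => ?_
    rw [map_smul, hb' i, Rat.cast_smul_eq_qsmul]
  have hdet := X.det_ι (∑ i, q i • (b i : X.B))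
  rw [hι] at hdet
  have hneg : (∑ i, (q i : ℝ) • b' i).det < 0 := hr
  rw [hdet] at hneg
  exact_mod_cast hneg

/-! ### The standard local models at `p ∤ D` -/

/-- **At a prime `p ∤ D`, `O₍ₚ₎` is a standard local Eichler order**: for some matrix model
`Ψ : B → M₂(ℚ_p)` and some `e ≥ 0`, `O₍ₚ₎ = {x | Ψ(x) ∈ M₂(ℤ_p), ‖Ψ(x)₂₁‖ ≤ p^{-e}}`
(`e = 0`, i.e. `O₍ₚ₎ = Ψ⁻¹(M₂(ℤ_p))`, when `p ∤ M`). [cite: VignerasLNM800, Ch. II §2 Thm. 2.3 (2) and Lemme 2.4] -/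
theorem exists_eichler_model_localAt (hD : 1 < D) (hM : 0 < M) {p : ℕ} [hp : Fact p.Prime]
    (hpD : ¬ p ∣ D) :
    ∃ (Ψ : X.B →ₐ[ℚ] Matrix (Fin 2) (Fin 2) ℚ_[p]) (e : ℕ),
      ∀ x : X.B, x ∈ localAt p X.O ↔ (∀ i j, ‖Ψ x i j‖ ≤ 1) ∧ ‖Ψ x 1 0‖ ≤ (p : ℝ) ^ (-(e : ℤ)) := by
  have hdiv : ∀ x : X.B, x ≠ 0 → IsUnit x := fun x hx => X.isUnit_of_ne_zero hD x hx
  have hEO : IsEichlerOrder X.O M := isEichlerOrder_iff_brandt.mpr X.isEichlerOrder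
  obtain ⟨φ⟩ := exists_algHom_matrix_of_not_dvd X.mem_ramifiedPlaces_iff hpD
  by_cases hpM : p ∣ M
  · obtain ⟨O₁, O₂, hO₁, hO₂, hO, -⟩ := hEO
    obtain ⟨Ψ, e, -, hΛe⟩ := exists_eichler_model hdiv hO₁ hO₂ φ
    refine ⟨Ψ, e, fun x => ?_⟩
    rw [hO]
    exact hΛe x
  · obtain ⟨O₁, hO₁, -, hloc⟩ := hEO.exists_isMaximalZOrder_localAt_eq hM.ne' hp.out hpM
    obtain ⟨u, hu⟩ := hO₁.exists_conjUnit_localAt_iff hdiv φ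
    refine ⟨AlgHom.conjUnit φ u, 0, fun x => ?_⟩
    rw [hloc, hu x]
    simp only [CharP.cast_eq_zero, neg_zero, zpow_zero]
    exact ⟨fun h => ⟨h, h 1 0⟩, fun h => h.1⟩

/-! ### Elements of `O₍ₚ₎` with norm close to a prescribed unit -/

/-- **Local units are norms of `O₍ₚ₎` up to `p`-adically small factors** (`p ∤ D`): for a
rational `u` with `v_p(u) = 0` and `m ≥ 0` there is `g ∈ O₍ₚ₎` with `nrd(g) = u (1 + p^m r)` for
some `r ∈ ℤ₍ₚ₎` — approximate `diag(u, 1)` by `Ψ(g)` in the standard model of `O₍ₚ₎`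
(`AlgHom.exists_norm_sub_le`); the approximate form of the surjectivity of `nrd : O_pˣ → ℤ_pˣ`
for local Eichler orders. [cite: VignerasLNM800, Ch. II §2 (unités des ordres d'Eichler) and Ch. III §5 Cor. 5.7] -/
theorem exists_mem_localAt_reducedNorm_eq_mul_of_not_dvd (hD : 1 < D) (hM : 0 < M) {p : ℕ}
    (hp : p.Prime) (hpD : ¬ p ∣ D) {u : ℚ} (hu0 : u ≠ 0) (hu : padicValRat p u = 0) (m : ℕ) :
    ∃ g : X.B, g ∈ localAt p X.O ∧ ∃ r : ℚ, ¬ p ∣ r.den ∧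
      reducedNorm ℚ X.B g = u * (1 + (p : ℚ) ^ m * r) := by
  haveI : Fact p.Prime := ⟨hp⟩
  have hpR : (0 : ℝ) < p := by exact_mod_cast hp.pos
  have hp1 : (1 : ℝ) < p := by exact_mod_cast hp.one_lt
  have hpQ : (p : ℚ) ≠ 0 := Nat.cast_ne_zero.mpr hp.ne_zero
  obtain ⟨Ψ, e, hΛ⟩ := X.exists_eichler_model_localAt hD hM hpD
  -- the target `diag(u, 1)` and an approximation `Ψ g`
  set T : Matrix (Fin 2) (Fin 2) ℚ_[p] := !![((u : ℚ) : ℚ_[p]), 0; 0, 1] with hT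
  obtain ⟨g, hg⟩ := AlgHom.exists_norm_sub_le Ψ T (m + e)
  have hunorm : ‖((u : ℚ) : ℚ_[p])‖ = 1 := by
    rw [Padic.norm_ratCast_eq_zpow hu0, hu, neg_zero, zpow_zero]
  have hε1 : (p : ℝ) ^ (-((m + e : ℕ) : ℤ)) ≤ 1 := zpow_le_one_of_nonpos₀ hp1.le (by omega)
  have hεe : (p : ℝ) ^ (-((m + e : ℕ) : ℤ)) ≤ (p : ℝ) ^ (-(e : ℤ)) :=
    zpow_le_zpow_right₀ hp1.le (by push_cast; omega)
  have hTnorm : ∀ i j, ‖T i j‖ ≤ 1 := by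
    intro i j
    fin_cases i <;> fin_cases j <;> simp [hT, hunorm]
  set E : Matrix (Fin 2) (Fin 2) ℚ_[p] := Ψ g - T with hE
  have hEnorm : ∀ i j, ‖E i j‖ ≤ (p : ℝ) ^ (-((m + e : ℕ) : ℤ)) := hg
  have hΨg : Ψ g = T + E := by rw [hE]; abel
  -- `g ∈ O₍ₚ₎`
  have hgΛ : g ∈ localAt p X.O := by
    rw [hΛ]
    refine ⟨fun i j => ?_, ?_⟩
    · rw [hΨg, Matrix.add_apply]
      exact (Padic.nonarchimedean _ _).trans (max_le (hTnorm i j) ((hEnorm i j).trans hε1))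
    · rw [hΨg, Matrix.add_apply]
      have hT10 : T 1 0 = 0 := by simp [hT]
      rw [hT10, zero_add]
      exact (hEnorm 1 0).trans hεe
  -- `det Ψ g = u + δ` with `‖δ‖ ≤ p^{-(m+e)}`
  have hdet : (Ψ g).det = ((u : ℚ) : ℚ_[p]) + (((u : ℚ) : ℚ_[p]) * E 1 1 + E 0 0 + E 0 0 * E 1 1 - E 0 1 * E 1 0) := by
    rw [hΨg, Matrix.det_fin_two]
    simp only [Matrix.add_apply, hT, Matrix.of_apply, Matrix.cons_val', Matrix.cons_val_zero,
      Matrix.cons_val_one, Matrix.empty_val', Matrix.cons_val_fin_one]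
    ring
  set δ : ℚ_[p] := ((u : ℚ) : ℚ_[p]) * E 1 1 + E 0 0 + E 0 0 * E 1 1 - E 0 1 * E 1 0 with hδ
  have hδnorm : ‖δ‖ ≤ (p : ℝ) ^ (-((m + e : ℕ) : ℤ)) := by
    have hε0 : (0 : ℝ) ≤ (p : ℝ) ^ (-((m + e : ℕ) : ℤ)) := zpow_nonneg hpR.le _
    have h1 : ‖((u : ℚ) : ℚ_[p]) * E 1 1‖ ≤ (p : ℝ) ^ (-((m + e : ℕ) : ℤ)) := by
      rw [norm_mul, hunorm, one_mul]; exact hEnorm 1 1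
    have h2 : ‖E 0 0 * E 1 1‖ ≤ (p : ℝ) ^ (-((m + e : ℕ) : ℤ)) := by
      rw [norm_mul]
      exact (mul_le_mul (hEnorm 0 0) ((hEnorm 1 1).trans hε1) (norm_nonneg _) hε0).trans
        (by rw [mul_one])
    have h3 : ‖E 0 1 * E 1 0‖ ≤ (p : ℝ) ^ (-((m + e : ℕ) : ℤ)) := by
      rw [norm_mul]
      exact (mul_le_mul (hEnorm 0 1) ((hEnorm 1 0).trans hε1) (norm_nonneg _) hε0).trans
        (by rw [mul_one])
    rw [hδ, sub_eq_add_neg]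
    refine (Padic.nonarchimedean _ _).trans (max_le ?_ (by rw [norm_neg]; exact h3))
    refine (Padic.nonarchimedean _ _).trans (max_le ?_ h2)
    exact (Padic.nonarchimedean _ _).trans (max_le h1 (hEnorm 0 0))
  -- `nrd g - u = δ` as a rational number
  have hnrd : ((reducedNorm ℚ X.B g : ℚ) : ℚ_[p]) - ((u : ℚ) : ℚ_[p]) = δ := by
    have h := AlgHom.det_eq_reducedNorm Ψ g
    rw [hdet] at h
    rw [show ((reducedNorm ℚ X.B g : ℚ) : ℚ_[p]) = algebraMap ℚ ℚ_[p] (reducedNorm ℚ X.B g) from rfl,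
      ← h]
    ring
  -- the quotient `r = (nrd g - u) / (u p^m)` is `p`-integral
  set r : ℚ := (reducedNorm ℚ X.B g - u) / (u * (p : ℚ) ^ m) with hr
  refine ⟨g, hgΛ, r, ?_, ?_⟩
  · rw [← Padic.norm_ratCast_le_one_iff, hr]
    push_cast
    rw [hnrd, norm_div, norm_mul, hunorm, one_mul, norm_pow, Padic.norm_p, inv_pow,
      div_le_one (by positivity)]
    calc ‖δ‖ ≤ (p : ℝ) ^ (-((m + e : ℕ) : ℤ)) := hδnorm
      _ ≤ (p : ℝ) ^ (-(m : ℤ)) := zpow_le_zpow_right₀ hp1.le (by push_cast; omega)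
      _ = ((p : ℝ) ^ m)⁻¹ := by rw [zpow_neg, zpow_natCast]
  · rw [hr]
    field_simp
    ring

end ShimuraCurveData

end Literature.NumberTheory.Automorphic
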